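import Literature.NumberTheory.PAdicHodge.CyclotomicTower
import Literature.NumberTheory.PAdicHodge.TateAlmostEtalePolynomialNorms
import Mathlib.FieldTheory.Normal.Basic
import Mathlib.RingTheory.Coprime.Lemmas
import HarnessLib

/-!
# Tate's almost étale lemma — the Galois gauge `g ↦ ‖g x − x‖` on a finite Galois layer of `F̄/ℚ_p`

Continuation of `TateAlmostEtaleCombinatorics` (the finite-group core) in the setting of the tree's
`PadicBaseField` / `BaseGaloisAction` / `CyclotomicTower`: `F` a non-archimedean local field of
characteristic `0` and residue characteristic `p`, `K₀ = PadicBase F p hp ≅ ℚ_p` (normed by `F`),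
`F̄ = NormedAlgClosure F`.  For a finite normal intermediate field `K₀ ⊆ Ω ⊆ F̄` with group
`G = Gal(Ω/K₀) = Ω ≃ₐ[K₀] Ω` and an element `x ∈ Ω`, the GAUGE of Serre's ramification theory is
`N_x(g) = ‖g x − x‖` (Serre, *Local Fields* IV §1: `i_G(g) = v(g x − x)` for a generator `x` of the
integers).  This file proves, WITHOUT any structure theory of local fields:

* (§1 = the ultrametric polynomial toolkit of `TateAlmostEtalePolynomialNorms`;)
* §2 `G` acts on `Ω` by isometries of `F̄` (every `g` is the restriction of an element of
  `G₀ = Gal(F̄/K₀)`, which is isometric: `BaseGaloisGroup.norm_smul`), and the gauge is ultrametric: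
  `N(g⁻¹) = N(g)`, `N(gh) ≤ max (N g) (N h)`, `N ≤ 1` for `x` integral, and `‖g z − z‖ ≤ N(g)` for
  every `z ∈ ℤ_p[x]` (`norm_gal_aeval_sub_le`);
* §3 **Serre IV §1 Prop. 3, "`≤`" half** (`norm_sub_le_prod_gauge`): if `y₀ = P(x)` with
  `P ∈ ℤ_p[X]` is fixed by a subgroup `C`, then for every `σ`,
  `‖σ y₀ − y₀‖ ≤ ∏_{τ ∈ C} N(σ τ)` — because `∏_{τ∈C} (X − τx)` divides `P(X) − y₀`, with a
  quotient that has integral coefficients (Gauss's lemma in norm form);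
* §4 **Serre IV §1 Prop. 3, "`≥`" half for an explicit base** (`prod_gauge_le_norm_sub`): if the
  `H`-fixed integers of `Ω` are `ℤ_p[ζ']` (hypothesis `hgen`, in the application `ζ' = ζ_{p^n} − 1`
  and `Ω^H = ℚ_p(ζ_{p^n})`, file `TateAlmostEtaleCyclotomic`), then for every `τ`,
  `∏_{h ∈ H} N(τ h) ≤ ‖τ ζ' − ζ'‖` — the coefficients of `f_H = ∏_{h∈H}(X − h x)` lie in `ℤ_p[ζ']`,
  so `τ f_H − f_H` has coefficients divisible by `τζ' − ζ'`, and `(τ f_H)(x) = ∏_h (x − τ h x)`;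
* §5 the **trace-one element** (`sum_gal_traceOneElt_eq_one`, Euler/Lagrange): for `x` with trivial
  stabiliser in `H`, `y = x^{d−1} / ∏_{h ≠ 1}(x − h x)` (`d = |H|`) satisfies `Σ_{h ∈ H} h y = 1`,
  and `‖y‖ = ‖x‖^{d−1} / ∏_{h≠1} N(h)` (`norm_traceOneElt`).

With the combinatorial core these give Tate 1967 §3.2 Prop. 9 (file `TateAlmostEtale`).  Nothing
here is a definition or a named fact; the gauge is always written out as `‖↑(g x) − ↑x‖`.

References: J.-P. Serre, *Local Fields*, Ch. IV §1 Prop. 2–3, Ch. III §6 (Euler's lemma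
`Tr(x^i/f'(x))`) [SerreLocalFields1979]; J. Tate, *p-divisible groups* (1967) §3.2 [Tate1967].
-/

noncomputable section

open scoped Classical
open Polynomial Finset

namespace Literature.NumberTheory.PAdicHodge.TateAlmostEtale



/-! ## §2 The finite Galois layer `Ω` and its gauge -/

section Layer

open ValuativeRel
open Literature.NumberTheory.GaloisRepresentations
open Literature.NumberTheory.GaloisRepresentations.IsNonarchimedeanLocalField

variable {F : Type} [Field F] [ValuativeRel F] [TopologicalSpace F] [IsNonarchimedeanLocalField F]
  [CharZero F] {p : ℕ} [Fact p.Prime] (hp : valuation F p < 1)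
variable (Ω : IntermediateField (PadicBase F p hp) (NormedAlgClosure F))
  [Normal (PadicBase F p hp) Ω]

/-- Every `g ∈ Gal(Ω/K₀)` is the restriction of an element of `G₀ = Gal(F̄/K₀)` (`F̄/K₀` is normal,
Mathlib `AlgEquiv.restrictNormalHom_surjective`).
[cite: SerreLocalFields1979, Ch. IV §1 (G acts on the integers of L; restriction from Gal(K̄/K))] -/
theorem exists_base_forall_coe_eq (g : Ω ≃ₐ[PadicBase F p hp] Ω) :
    ∃ g₀ : BaseGaloisGroup hp, ∀ z : Ω,
      ((g z : Ω) : NormedAlgClosure F) = g₀ • (z : NormedAlgClosure F) := by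
  obtain ⟨g₀, hg₀⟩ := AlgEquiv.restrictNormalHom_surjective
    (F := PadicBase F p hp) (K₁ := Ω) (E := NormedAlgClosure F) g
  refine ⟨g₀, fun z => ?_⟩
  rw [← hg₀]
  exact AlgEquiv.restrictNormalHom_apply Ω g₀ z

/-- **`Gal(Ω/K₀)` acts by isometries** (for the absolute value of `F̄`): `‖g z‖ = ‖z‖`.
[cite: SerreLocalFields1979, Ch. IV §1 (the Galois group preserves the valuation)] -/
theorem norm_coe_gal (g : Ω ≃ₐ[PadicBase F p hp] Ω) (z : Ω) :
    ‖((g z : Ω) : NormedAlgClosure F)‖ = ‖(z : NormedAlgClosure F)‖ := by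
  obtain ⟨g₀, hg₀⟩ := exists_base_forall_coe_eq hp Ω g
  rw [hg₀ z, BaseGaloisGroup.norm_smul]

/-- The gauge is symmetric: `‖g⁻¹ x − x‖ = ‖g x − x‖`. [cite: SerreLocalFields1979, Ch. IV §1 Prop. 2 (properties of i_G)] -/
theorem gauge_inv (g : Ω ≃ₐ[PadicBase F p hp] Ω) (x : Ω) :
    ‖((g⁻¹ x : Ω) : NormedAlgClosure F) - x‖ = ‖((g x : Ω) : NormedAlgClosure F) - x‖ := by
  have h := norm_coe_gal hp Ω g (g⁻¹ x - x)
  rw [map_sub, ← AlgEquiv.mul_apply, mul_inv_cancel, AlgEquiv.one_apply] at h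
  push_cast at h
  rw [← h, norm_sub_rev]

/-- The gauge is ultrametric: `‖(g h) x − x‖ ≤ max ‖g x − x‖ ‖h x − x‖`
(`gh x − x = g (h x − x) + (g x − x)`). [cite: SerreLocalFields1979, Ch. IV §1 Prop. 2 (the G_i are subgroups)] -/
theorem gauge_mul_le (g h : Ω ≃ₐ[PadicBase F p hp] Ω) (x : Ω) :
    ‖(((g * h) x : Ω) : NormedAlgClosure F) - x‖ ≤
      max ‖((g x : Ω) : NormedAlgClosure F) - x‖ ‖((h x : Ω) : NormedAlgClosure F) - x‖ := by
  have e : (((g * h) x : Ω) : NormedAlgClosure F) - x =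
      (((g (h x - x) : Ω) : NormedAlgClosure F)) + ((((g x : Ω) : NormedAlgClosure F)) - x) := by
    rw [AlgEquiv.mul_apply, map_sub]; push_cast; ring
  rw [e, max_comm]
  refine (IsUltrametricDist.norm_add_le_max _ _).trans (max_le_max_right _ ?_)
  rw [norm_coe_gal]; push_cast; exact le_rfl

omit [Normal (PadicBase F p hp) Ω] in
/-- The gauge of the identity vanishes (`i_G(1) = +∞`).
[cite: SerreLocalFields1979, Ch. IV §1 Prop. 2 (properties of i_G)] -/
theorem gauge_one (x : Ω) : ‖(((1 : Ω ≃ₐ[PadicBase F p hp] Ω) x : Ω) : NormedAlgClosure F) - x‖ = 0 := by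
  rw [AlgEquiv.one_apply, sub_self, norm_zero]

/-- For an INTEGRAL `x` the gauge is `≤ 1`. [cite: SerreLocalFields1979, Ch. IV §1 (i_G ≥ 0 on integers)] -/
theorem gauge_le_one (g : Ω ≃ₐ[PadicBase F p hp] Ω) {x : Ω} (hx : ‖(x : NormedAlgClosure F)‖ ≤ 1) :
    ‖((g x : Ω) : NormedAlgClosure F) - x‖ ≤ 1 :=
  (norm_sub_le_max' _ _).trans (max_le (by rw [norm_coe_gal]; exact hx) hx)

omit [Normal (PadicBase F p hp) Ω] in
/-- The gauge is positive off the stabiliser (`i_G(s) < ∞` for `s ≠ 1` when `G` acts faithfully).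
[cite: SerreLocalFields1979, Ch. IV §1 Prop. 2 (properties of i_G)] -/
theorem gauge_pos {g : Ω ≃ₐ[PadicBase F p hp] Ω} {x : Ω} (h : g x ≠ x) :
    0 < ‖((g x : Ω) : NormedAlgClosure F) - x‖ := by
  rw [norm_pos_iff, sub_ne_zero]
  exact fun e => h (Subtype.ext e)

/-- **`‖g z − z‖ ≤ ‖g x − x‖` for every `z = P(x) ∈ ℤ_p[x]`** (`P` with integral coefficients, `x`
integral): Serre's `i_G(g) = v(gx − x)` bounds `v(gz − z)` for all integers `z` when `x` generates
them. [cite: SerreLocalFields1979, Ch. IV §1 Lemma 1] -/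
theorem norm_gal_aeval_sub_le (g : Ω ≃ₐ[PadicBase F p hp] Ω) {x : Ω}
    (hx : ‖(x : NormedAlgClosure F)‖ ≤ 1) (P : (PadicBase F p hp)[X]) (hP : ∀ j, ‖P.coeff j‖ ≤ 1) :
    ‖((g (aeval x P) : Ω) : NormedAlgClosure F) - (aeval x P : Ω)‖ ≤
      ‖((g x : Ω) : NormedAlgClosure F) - x‖ := by
  rw [← Polynomial.aeval_algHom_apply g x P, ← IntermediateField.aeval_coe,
    ← IntermediateField.aeval_coe, aeval_def, aeval_def, ← eval_map, ← eval_map]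
  refine norm_eval_sub_eval_le _ (fun j => ?_) (by rw [norm_coe_gal]; exact hx) hx
  rw [coeff_map, PadicBase.norm_algebraMap_closure]
  exact hP j

/-! ## §3 Serre IV §1 Prop. 3, the "`≤`" half -/

omit [Normal (PadicBase F p hp) Ω] in
/-- The map `τ ↦ τ x` is injective on `Gal(Ω/K₀)` when `x` has trivial stabiliser (the conjugates
`τ x` of a generator are distinct). [cite: SerreLocalFields1979, Ch. IV §1 Lemma 1 (x generates, conjugates distinct)] -/
theorem injective_coe_gal_apply {x : Ω} (hfree : ∀ g : Ω ≃ₐ[PadicBase F p hp] Ω, g x = x → g = 1)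
    (C : Subgroup (Ω ≃ₐ[PadicBase F p hp] Ω)) :
    Function.Injective fun τ : C => (((τ : Ω ≃ₐ[PadicBase F p hp] Ω) x : Ω) : NormedAlgClosure F) := by
  intro τ τ' h
  apply Subtype.ext
  have h' : (τ : Ω ≃ₐ[PadicBase F p hp] Ω) x = (τ' : Ω ≃ₐ[PadicBase F p hp] Ω) x := Subtype.ext h
  have h1 : ((τ : Ω ≃ₐ[PadicBase F p hp] Ω)⁻¹ * τ') x = x := by
    rw [AlgEquiv.mul_apply, ← h', ← AlgEquiv.mul_apply, inv_mul_cancel, AlgEquiv.one_apply]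
  exact inv_mul_eq_one.mp (hfree _ h1)

omit [Normal (PadicBase F p hp) Ω] in
/-- For `x ∈ Ω` integral and `P` with integral coefficients, `y₀ = P(x)` is integral.
[cite: SerreLocalFields1979, Ch. IV §1 (A[x] ⊆ B)] -/
theorem norm_coe_aeval_le_one {x : Ω} (hx : ‖(x : NormedAlgClosure F)‖ ≤ 1)
    (P : (PadicBase F p hp)[X]) (hP : ∀ j, ‖P.coeff j‖ ≤ 1) :
    ‖((aeval x P : Ω) : NormedAlgClosure F)‖ ≤ 1 := by
  rw [← IntermediateField.aeval_coe, aeval_def, ← eval_map]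
  exact norm_eval_le_of_coeff_le _ zero_le_one
    (fun j => by rw [coeff_map, PadicBase.norm_algebraMap_closure]; exact hP j) hx

/-- **Serre IV §1 Prop. 3, "`≤`" half, norm form.** Let `x ∈ Ω` be integral with trivial
stabiliser in `G = Gal(Ω/K₀)`, `y₀ = P(x)` with `P ∈ ℤ_p[X]`, and `C ≤ G` a subgroup fixing `y₀`.
Then for every `σ ∈ G`: `‖σ y₀ − y₀‖ ≤ ∏_{τ ∈ C} ‖(στ) x − x‖`.  Proof: `f_C = ∏_{τ∈C}(X − τx)`
divides `P(X) − y₀` (both vanish at the `τ x`), the cofactor `q` is integral (Gauss), and applying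
a lift `σ₀ ∈ G₀` of `σ` and evaluating at `x` gives `y₀ − σ y₀ = ∏_τ (x − στx) · (σ q)(x)`.
This is Serre's `e_{L/K'} · i_{G/H}(σ) = Σ_{s→σ} i_G(s)` in the direction that needs only
`y₀ ∈ ℤ_p[x]`. [cite: SerreLocalFields1979, Ch. IV §1 Prop. 3] -/
theorem norm_sub_le_prod_gauge [FiniteDimensional (PadicBase F p hp) Ω]
    {x : Ω} (hx : ‖(x : NormedAlgClosure F)‖ ≤ 1)
    (hfree : ∀ g : Ω ≃ₐ[PadicBase F p hp] Ω, g x = x → g = 1)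
    (P : (PadicBase F p hp)[X]) (hP : ∀ j, ‖P.coeff j‖ ≤ 1)
    (C : Subgroup (Ω ≃ₐ[PadicBase F p hp] Ω)) (hC : ∀ τ ∈ C, τ (aeval x P) = aeval x P)
    (σ : Ω ≃ₐ[PadicBase F p hp] Ω) :
    ‖((σ (aeval x P) : Ω) : NormedAlgClosure F) - (aeval x P : Ω)‖ ≤
      ∏ τ : C, ‖(((σ * τ) x : Ω) : NormedAlgClosure F) - x‖ := by
  set K₀ := PadicBase F p hp
  set L := NormedAlgClosure F
  set y₀ : Ω := aeval x P with hy₀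
  -- the nodes `τ x`, `τ ∈ C`, are distinct
  let v : C → L := fun τ => (((τ : Ω ≃ₐ[K₀] Ω) x : Ω) : L)
  have hv : Function.Injective v := injective_coe_gal_apply hp Ω hfree C
  let f : L[X] := Lagrange.nodal Finset.univ v
  let Q : L[X] := P.map (algebraMap K₀ L) - Polynomial.C (y₀ : L)
  -- `Q` vanishes at the nodes
  have hQroot : ∀ τ : C, Q.IsRoot (v τ) := by
    intro τ
    rw [IsRoot, eval_sub, eval_C, eval_map, ← aeval_def]
    change aeval ((((τ : Ω ≃ₐ[K₀] Ω) x : Ω)) : L) P - (y₀ : L) = 0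
    rw [IntermediateField.aeval_coe, aeval_algHom_apply, ← hy₀, hC _ τ.2, sub_self]
  -- hence `f ∣ Q`, say `Q = f * q`
  have hdvd : f ∣ Q := by
    rw [show f = ∏ τ : C, (X - Polynomial.C (v τ)) from Lagrange.nodal_eq _ _]
    exact Fintype.prod_dvd_of_coprime (pairwise_coprime_X_sub_C hv)
      fun τ => dvd_iff_isRoot.mpr (hQroot τ)
  obtain ⟨q, hq⟩ := hdvd
  -- integrality of `Q`, hence of `q`
  have hQ1 : ∀ j, ‖Q.coeff j‖ ≤ 1 := by
    intro j
    change ‖(P.map (algebraMap K₀ L) - Polynomial.C (y₀ : L)).coeff j‖ ≤ 1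
    rw [coeff_sub, coeff_map, coeff_C]
    split_ifs with hj
    · refine (norm_sub_le_max' _ _).trans (max_le ?_ (norm_coe_aeval_le_one hp Ω hx P hP))
      rw [PadicBase.norm_algebraMap_closure]; exact hP _
    · rw [sub_zero, PadicBase.norm_algebraMap_closure]; exact hP j
  have hq1 : ∀ j, ‖q.coeff j‖ ≤ 1 :=
    norm_coeff_le_one_of_monic_mul (Lagrange.nodal_monic (s := Finset.univ) (v := v))
      (fun j => by rw [← hq]; exact hQ1 j)
  -- apply a lift `σ₀ ∈ G₀` of `σ` and evaluate at `x`
  obtain ⟨σ₀, hσ₀⟩ := exists_base_forall_coe_eq hp Ω σ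
  let φ : L →+* L := (σ₀ : L ≃ₐ[K₀] L)
  have hφP : (P.map (algebraMap K₀ L)).map φ = P.map (algebraMap K₀ L) := by
    rw [Polynomial.map_map]
    congr 1
    ext c
    exact σ₀.commutes c
  have key := congrArg (fun R : L[X] => (R.map φ).eval (x : L)) hq
  simp only [Q, f] at key
  rw [Polynomial.map_sub, hφP, Polynomial.map_C, eval_sub, eval_C, eval_map, ← aeval_def,
    IntermediateField.aeval_coe, ← hy₀, Polynomial.map_mul, eval_mul, map_nodal, Lagrange.eval_nodal]
    at key
  -- `φ y₀ = σ y₀`, `φ (τ x) = (σ τ) x`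
  have hφy : φ (y₀ : L) = ((σ y₀ : Ω) : L) := (hσ₀ y₀).symm
  have hφv : ∀ τ : C, (φ ∘ v) τ = (((σ * τ) x : Ω) : L) := fun τ => by
    change σ₀ • ((((τ : Ω ≃ₐ[K₀] Ω) x : Ω)) : L) = _
    rw [← hσ₀, AlgEquiv.mul_apply]
  rw [hφy] at key
  simp only [hφv] at key
  -- norms
  rw [norm_sub_rev, key, norm_mul, norm_prod]
  have hqσ : ‖(q.map φ).eval (x : L)‖ ≤ 1 := by
    refine norm_eval_le_of_coeff_le _ zero_le_one (fun j => ?_) hx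
    rw [coeff_map]
    change ‖σ₀ • q.coeff j‖ ≤ 1
    rw [BaseGaloisGroup.norm_smul]
    exact hq1 j
  calc (∏ τ : C, ‖(x : L) - (((σ * τ) x : Ω) : L)‖) * ‖(q.map φ).eval (x : L)‖
      ≤ (∏ τ : C, ‖(x : L) - (((σ * τ) x : Ω) : L)‖) * 1 := by gcongr
    _ = ∏ τ : C, ‖(((σ * τ) x : Ω) : L) - x‖ := by
        rw [mul_one]; exact Finset.prod_congr rfl fun τ _ => norm_sub_rev _ _

/-! ## §4 Serre IV §1 Prop. 3, the "`≥`" half over an explicit base `ℤ_p[ζ']` -/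

omit [Normal (PadicBase F p hp) Ω] in
/-- The nodal polynomial `f_H = ∏_{h ∈ H} (X − h x)` is invariant under `H` (left multiplication
permutes the nodes); its coefficients therefore lie in the fixed field (Serre: `f ∈ 𝒪_{K'}[X]` is
the minimal polynomial of `x` over `K'`). [cite: SerreLocalFields1979, Ch. IV §1 Prop. 3 (proof)] -/
theorem map_gal_nodal_eq [FiniteDimensional (PadicBase F p hp) Ω] (x : Ω)
    (H : Subgroup (Ω ≃ₐ[PadicBase F p hp] Ω)) {h₀ : Ω ≃ₐ[PadicBase F p hp] Ω} (hh₀ : h₀ ∈ H) :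
    (Lagrange.nodal Finset.univ (fun h : H => (h : Ω ≃ₐ[PadicBase F p hp] Ω) x)).map
        (h₀ : Ω →+* Ω) =
      Lagrange.nodal Finset.univ (fun h : H => (h : Ω ≃ₐ[PadicBase F p hp] Ω) x) := by
  rw [map_nodal, Lagrange.nodal_eq, Lagrange.nodal_eq]
  exact Fintype.prod_equiv (Equiv.mulLeft ⟨h₀, hh₀⟩) _ _ fun h => by
    simp only [Function.comp_apply, Equiv.coe_mulLeft, Subgroup.coe_mul, AlgEquiv.mul_apply]
    rfl

/-- **Serre IV §1 Prop. 3, "`≥`" half, norm form, over an explicit base.** Let `x ∈ Ω` be integral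
with trivial stabiliser, `H ≤ Gal(Ω/K₀)`, and `ζ' ∈ Ω` integral such that every `H`-fixed integer
of `Ω` is `s(ζ')` for some `s ∈ ℤ_p[X]` (i.e. `𝒪_{Ω^H} = ℤ_p[ζ']`; in the application
`Ω^H = ℚ_p(ζ_{p^n})`, `ζ' = ζ_{p^n} − 1`).  Then for every `τ`:
`∏_{h ∈ H} ‖(τh) x − x‖ ≤ ‖τ ζ' − ζ'‖`.  Proof: the coefficients of `f_H = ∏_{h∈H}(X − hx)` are
`H`-fixed integers, hence in `ℤ_p[ζ']`, so the coefficients of `τf_H − f_H` have norm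
`≤ ‖τζ' − ζ'‖`; and `(τ f_H − f_H)(x) = ∏_h (x − τ h x)`.  This is Serre's identity
`e_{L/K'} · i_{G/H}(τ) = Σ_{s→τ} i_G(s)` in the direction that needs `𝒪_{K'} = 𝒪_K[y]`.
[cite: SerreLocalFields1979, Ch. IV §1 Prop. 3 and Lemma 1] -/
theorem prod_gauge_le_norm_sub [FiniteDimensional (PadicBase F p hp) Ω]
    {x : Ω} (hx : ‖(x : NormedAlgClosure F)‖ ≤ 1)
    (H : Subgroup (Ω ≃ₐ[PadicBase F p hp] Ω)) {ζ' : Ω} (hζ' : ‖(ζ' : NormedAlgClosure F)‖ ≤ 1)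
    (hgen : ∀ c : Ω, (∀ h ∈ H, h c = c) → ‖(c : NormedAlgClosure F)‖ ≤ 1 →
      ∃ s : (PadicBase F p hp)[X], (∀ j, ‖s.coeff j‖ ≤ 1) ∧ aeval ζ' s = c)
    (τ : Ω ≃ₐ[PadicBase F p hp] Ω) :
    ∏ h : H, ‖(((τ * h) x : Ω) : NormedAlgClosure F) - x‖ ≤
      ‖((τ ζ' : Ω) : NormedAlgClosure F) - ζ'‖ := by
  let w : H → Ω := fun h => (h : Ω ≃ₐ[PadicBase F p hp] Ω) x
  let f : Polynomial Ω := Lagrange.nodal Finset.univ w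
  -- the coefficients of `f` are `H`-fixed integers, hence in `ℤ_p[ζ']`
  have hfix : ∀ j, ∀ h ∈ H, h (f.coeff j) = f.coeff j := by
    intro j h hh
    have e := congrArg (fun R : Polynomial Ω => R.coeff j) (map_gal_nodal_eq hp Ω x H hh)
    rw [coeff_map] at e
    exact e
  have hint : ∀ j, ‖((f.coeff j : Ω) : NormedAlgClosure F)‖ ≤ 1 := by
    intro j
    have e : ((f.coeff j : Ω) : NormedAlgClosure F) =
        (f.map (algebraMap Ω (NormedAlgClosure F))).coeff j := by rw [coeff_map]; rfl
    rw [e, map_nodal]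
    exact norm_coeff_nodal_le_one _ _ (fun h _ => by
      change ‖((((h : Ω ≃ₐ[PadicBase F p hp] Ω) x : Ω)) : NormedAlgClosure F)‖ ≤ 1
      rw [norm_coe_gal]; exact hx) j
  choose s hs1 hs2 using fun j => hgen (f.coeff j) (hfix j) (hint j)
  -- `D = τ f − f` has coefficients of norm `≤ ‖τ ζ' − ζ'‖` and `D(x) = ∏_h (x − τ h x)`
  let D : Polynomial Ω := f.map (τ : Ω →+* Ω) - f
  have hDcoeff : ∀ j, ‖((D.map (algebraMap Ω (NormedAlgClosure F))).coeff j)‖ ≤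
      ‖((τ ζ' : Ω) : NormedAlgClosure F) - ζ'‖ := by
    intro j
    rw [coeff_map]
    change ‖(((f.map (τ : Ω →+* Ω) - f).coeff j : Ω) : NormedAlgClosure F)‖ ≤ _
    rw [coeff_sub, coeff_map, ← hs2 j]
    push_cast
    exact norm_gal_aeval_sub_le hp Ω τ hζ' (s j) (hs1 j)
  have hDeval : (D.map (algebraMap Ω (NormedAlgClosure F))).eval (x : NormedAlgClosure F) =
      ∏ h : H, ((x : NormedAlgClosure F) - (((τ * h) x : Ω) : NormedAlgClosure F)) := by
    rw [show ((x : Ω) : NormedAlgClosure F) = algebraMap Ω (NormedAlgClosure F) x from rfl,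
      eval_map, eval₂_at_apply]
    change (algebraMap Ω (NormedAlgClosure F)) ((f.map (τ : Ω →+* Ω) - f).eval x) = _
    have hw1 : w 1 = x := by
      change ((1 : H) : Ω ≃ₐ[PadicBase F p hp] Ω) x = x
      rw [OneMemClass.coe_one, AlgEquiv.one_apply]
    have hf0 : f.eval x = 0 := by
      rw [← hw1]
      exact Lagrange.eval_nodal_at_node (Finset.mem_univ (1 : H))
    rw [eval_sub, hf0, map_nodal, Lagrange.eval_nodal, sub_zero, map_prod]
    refine Finset.prod_congr rfl fun h _ => ?_
    rw [map_sub, Function.comp_apply, AlgEquiv.mul_apply]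
    rfl
  have key := norm_eval_le_of_coeff_le (D.map (algebraMap Ω (NormedAlgClosure F))) (norm_nonneg _)
    hDcoeff hx
  rw [hDeval, norm_prod] at key
  exact le_of_eq_of_le (Finset.prod_congr rfl fun h _ => norm_sub_rev _ _) key

/-! ## §5 The trace-one element `x^{d-1} / f_H'(x)` (Euler / Lagrange) -/

omit [Normal (PadicBase F p hp) Ω] in
/-- **Euler's trace-one element** (Euler's lemma `Tr(x^{d-1}/f'(x)) = 1`, Serre III §6 Lemma 2 /
Lagrange interpolation of `X^{d-1}`): for `x` with trivial stabiliser in the finite group `H` of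
automorphisms, `y = x^{d−1} / ∏_{h ≠ 1}(x − h x)` (`d = |H|`) has `Σ_{h ∈ H} h y = 1`.
[cite: SerreLocalFields1979, Ch. III §6 Lemma 2 (Euler)] -/
theorem sum_gal_traceOneElt_eq_one [FiniteDimensional (PadicBase F p hp) Ω] (x : Ω)
    (H : Subgroup (Ω ≃ₐ[PadicBase F p hp] Ω))
    (hfree : ∀ h ∈ H, h x = x → h = 1) :
    ∑ h : H, (h : Ω ≃ₐ[PadicBase F p hp] Ω)
        (x ^ (Fintype.card H - 1) /
          ∏ h' ∈ (Finset.univ : Finset H).erase 1, (x - (h' : Ω ≃ₐ[PadicBase F p hp] Ω) x)) = 1 := by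
  let w : H → Ω := fun h => (h : Ω ≃ₐ[PadicBase F p hp] Ω) x
  have hw : Set.InjOn w (Finset.univ : Finset H) := by
    intro h _ h' _ e
    change (h : Ω ≃ₐ[PadicBase F p hp] Ω) x = (h' : Ω ≃ₐ[PadicBase F p hp] Ω) x at e
    apply Subtype.ext
    have h1 : ((h : Ω ≃ₐ[PadicBase F p hp] Ω)⁻¹ * h') x = x := by
      rw [AlgEquiv.mul_apply, ← e, ← AlgEquiv.mul_apply, inv_mul_cancel, AlgEquiv.one_apply]
    exact inv_mul_eq_one.mp (hfree _ (H.mul_mem (H.inv_mem h.2) h'.2) h1)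
  have hcard : (Finset.univ : Finset H).card = Fintype.card H := Finset.card_univ
  have hd : 1 ≤ Fintype.card H := Fintype.card_pos
  have hdeg : (X ^ (Fintype.card H - 1) : Polynomial Ω).degree < (Finset.univ : Finset H).card := by
    rw [degree_X_pow, hcard]; exact_mod_cast Nat.sub_lt hd one_pos
  have key := Lagrange.coeff_eq_sum hw hdeg
  rw [hcard, coeff_X_pow_self] at key
  rw [key]
  refine Finset.sum_congr rfl fun h _ => ?_
  rw [eval_pow, eval_X, map_div₀, map_pow, map_prod]
  congr 1
  -- reindex `h' ↦ h h'` : `univ.erase 1 → univ.erase h`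
  refine Finset.prod_nbij (fun h' => h * h') (fun h' hh' => ?_) (fun a _ b _ e => mul_left_cancel e)
    (fun k hk => ?_) (fun h' _ => ?_)
  · rw [Finset.mem_erase] at hh' ⊢
    exact ⟨fun e => hh'.1 (mul_eq_left.mp e), Finset.mem_univ _⟩
  · rw [Finset.coe_erase, Set.mem_sdiff, Set.mem_singleton_iff] at hk
    refine ⟨h⁻¹ * k, ?_, by simp only [mul_inv_cancel_left]⟩
    rw [Finset.mem_coe, Finset.mem_erase]
    exact ⟨fun e => hk.2 (by rw [← mul_inv_cancel_left h k, e, mul_one]), Finset.mem_univ _⟩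
  · change _ = (h : Ω ≃ₐ[PadicBase F p hp] Ω) x - ((h * h' : H) : Ω ≃ₐ[PadicBase F p hp] Ω) x
    rw [map_sub, Subgroup.coe_mul, AlgEquiv.mul_apply]

omit [Normal (PadicBase F p hp) Ω] in
/-- The absolute value of the trace-one element: `‖x^{d−1}/∏_{h≠1}(x − hx)‖ = ‖x‖^{d−1} / ∏_{h ≠ 1} ‖hx − x‖`.
[cite: SerreLocalFields1979, Ch. III §6 Lemma 2 (Euler)] -/
theorem norm_traceOneElt [FiniteDimensional (PadicBase F p hp) Ω] (x : Ω)
    (H : Subgroup (Ω ≃ₐ[PadicBase F p hp] Ω)) :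
    ‖((x ^ (Fintype.card H - 1) /
        ∏ h' ∈ (Finset.univ : Finset H).erase 1, (x - (h' : Ω ≃ₐ[PadicBase F p hp] Ω) x) : Ω) :
        NormedAlgClosure F)‖ =
      ‖(x : NormedAlgClosure F)‖ ^ (Fintype.card H - 1) /
        ∏ h' ∈ (Finset.univ : Finset H).erase 1,
          ‖(((h' : Ω ≃ₐ[PadicBase F p hp] Ω) x : Ω) : NormedAlgClosure F) - x‖ := by
  push_cast
  rw [norm_div, norm_pow, norm_prod]
  congr 1
  exact Finset.prod_congr rfl fun h _ => norm_sub_rev _ _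

end Layer

end Literature.NumberTheory.PAdicHodge.TateAlmostEtale

end
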